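import Mathlib.Geometry.Manifold.PartitionOfUnity
import Mathlib.Analysis.Calculus.MeanValue
import Mathlib.MeasureTheory.Integral.IntervalIntegral.FundThmCalculus
import Mathlib.Analysis.SpecialFunctions.ExpDeriv
import Mathlib.Topology.MetricSpace.Thickening
import Mathlib.Analysis.Convex.Star
import Literature.Topology.FourManifolds.CompactSupportFlow
import Literature.Topology.FourManifolds.ChartFieldFlow
import HarnessLib

/-!
# Radial engulfing: stretching an open set over a star-shaped set by the flow of a compactly
# supported vector field given in a chart

Topic `Literature/Topology/FourManifolds`; the analytic step of the proof of the named fact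
`Literature.Topology.FourManifolds.exists_isSmoothEmbedding_closedBall_of_isSmoothlyCollapsible`
(`Collapsible.lean`; Hirsch 1962): *regular neighbourhoods stretch over an elementary collapse*
(Rourke–Sanderson 1972, Ch. 3; Rushing 1973, Exercise 1.6.12), in the smooth form used by the
tree's induction on the collapse — an ambient **diffeomorphism**, the time-`T` map of the flow
of a compactly supported vector field (Hirsch 1976, Ch. 8 §1, Thm. 1.2; the tree's
`CompactSupportFlow.lean`), so that smoothly embedded balls are carried to smoothly embedded balls.

Setting: `M` a Hausdorff `C^∞` manifold modelled on the finite-dimensional real normed space `E`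
(model `𝓘(ℝ, E)`, no boundary), `Φ : M ⊇ Φ.source → E` a chart of the maximal atlas, `o ∈ E`,
`Δ ⊆ Φ.target` compact and star-shaped about `o` (the simplex being collapsed, read in the
chart), `H ⊆ Δ`… more precisely `H ⊆ Φ.target` compact, star-shaped about `o` with `o ∈ H` (the
union of the facets through the apex), `C ⊆ M` closed (what is already engulfed) with
`Φ⁻¹(Δ) ∩ C ⊆ Φ⁻¹(H)`, `O ⊆ M` open containing `C` and `Φ⁻¹(H)`, `U ⊆ M` open containing
`Φ⁻¹(Δ)`.

* `exists_diffeomorph_mapsTo_image_supset` — **there is a diffeomorphism `G` of `M` with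
  `G(U) ⊆ U`, `C ⊆ G(O)` and `Φ⁻¹(Δ) ⊆ G(O)`.**

Construction (§4): `G` is the inverse of the time-`T` map of the flow of the push-forward
`chartField Φ V` (`ChartFieldFlow.lean`, here for a chart with arbitrary target, §1) of the radial
field `V y = λ(y) • (o - y)`, `λ : E → [0, 1]` a smooth bump equal to `1` on
`Δ_θ = {y ∈ Δ | θ ≤ infDist y H}` and supported in a compact subset of
`Φ(U ∩ Φ.source) ∖ {y | Φ⁻¹ y ∈ C, θ ≤ infDist y H}`, where the `θ`-thickening of `H` read back in
`M` lies in `O`.  Integral curves of `V` run along rays towards `o`: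
`γ t - o = exp (-∫₀ᵗ λ ∘ γ) • (γ 0 - o)` (§2, `sub_eq_exp_smul_of_hasDerivAt`), so `Δ` and the
`θ`-thickening of `H` (both star-shaped about `o`, §3) are forward invariant, and a track that
stays in `Δ_θ` up to time `T` contracts by `e^{-T}`; with `R e^{-T} < θ` (`Δ ⊆ B̄(o, R)`) every
point of `Φ⁻¹(Δ) ∪ C` is in `O` at time `T`.

Everything here is proved; no named facts are introduced.

## References

* M. W. Hirsch, *Differential Topology*, GTM 33 (1976), Ch. 8 §1, Thms. 1.1–1.2. [HirschDT1976]
* C. P. Rourke, B. J. Sanderson, *Introduction to piecewise-linear topology* (1972), Ch. 3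
  (regular neighbourhoods and collapsing). [RourkeSanderson1972]
* T. B. Rushing, *Topological embeddings* (1973), Exercise 1.6.12. [Rushing1973]
* M. W. Hirsch, *Smooth regular neighborhoods*, Ann. of Math. (2) 76 (1962) 524–530. [Hirsch1962]
-/

open scoped Manifold ContDiff Topology
open Set Function Filter Metric VectorField

noncomputable section

namespace Literature.Topology.FourManifolds

/-! ### §1 The push-forward of a compactly supported field along a chart with arbitrary target -/

section PartialChart

variable {E : Type*} [NormedAddCommGroup E] [NormedSpace ℝ E]
  {M : Type*} [TopologicalSpace M] [ChartedSpace E M]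
  {Φ : OpenPartialHomeomorph M E} {V : E → E}

/-- A chart of the maximal atlas is smooth at the points of its source. [folklore] -/
theorem contMDiffAt_of_mem_maximalAtlas' (hΦ : Φ ∈ IsManifold.maximalAtlas 𝓘(ℝ, E) ∞ M) {x : M}
    (hx : x ∈ Φ.source) : ContMDiffAt 𝓘(ℝ, E) 𝓘(ℝ, E) ∞ Φ x :=
  (contMDiffOn_of_mem_maximalAtlas hΦ).contMDiffAt (Φ.open_source.mem_nhds hx)

/-- The inverse of a chart of the maximal atlas is smooth at the points of its target.
[folklore] -/
theorem contMDiffAt_symm_of_mem_maximalAtlas' (hΦ : Φ ∈ IsManifold.maximalAtlas 𝓘(ℝ, E) ∞ M)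
    {y : E} (hy : y ∈ Φ.target) : ContMDiffAt 𝓘(ℝ, E) 𝓘(ℝ, E) ∞ Φ.symm y :=
  (contMDiffOn_symm_of_mem_maximalAtlas hΦ).contMDiffAt (Φ.open_target.mem_nhds hy)

/-- The differential of a chart of the maximal atlas is invertible on the source, with inverse
the differential of the inverse chart. [folklore] -/
theorem isInvertible_mfderiv_of_mem_maximalAtlas (hΦ : Φ ∈ IsManifold.maximalAtlas 𝓘(ℝ, E) ∞ M)
    {x : M} (hx : x ∈ Φ.source) :
    (mfderiv 𝓘(ℝ, E) 𝓘(ℝ, E) Φ x).IsInvertible ∧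
      (mfderiv 𝓘(ℝ, E) 𝓘(ℝ, E) Φ x).inverse = mfderiv 𝓘(ℝ, E) 𝓘(ℝ, E) Φ.symm (Φ x) := by
  have hn : (∞ : ℕ∞ω) ≠ 0 := by simp
  exact isInvertible_mfderiv_of_eventuallyEq
    ((contMDiffAt_of_mem_maximalAtlas' hΦ hx).mdifferentiableAt hn)
    ((contMDiffAt_symm_of_mem_maximalAtlas' hΦ (Φ.map_source hx)).mdifferentiableAt hn)
    (Φ.eventually_left_inverse hx) (Φ.eventually_right_inverse' hx)

/-- **`dΦ` carries the pushed-forward field back to `V`**: `dΦₓ (chartField Φ V x) = V (Φ x)`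
on the source. [cite: LeeSmoothManifolds2013, Prop. 8.19] -/
theorem mfderiv_apply_chartField (hΦ : Φ ∈ IsManifold.maximalAtlas 𝓘(ℝ, E) ∞ M) {x : M}
    (hx : x ∈ Φ.source) :
    mfderiv 𝓘(ℝ, E) 𝓘(ℝ, E) Φ x (chartField Φ V x) = V (Φ x) := by
  rw [chartField_of_mem hx, mpullback_apply]
  exact (isInvertible_mfderiv_of_mem_maximalAtlas hΦ hx).1.self_apply_inverse _

/-- The push-forward along the inverse chart of a track: `mpullback Φ⁻¹ (chartField Φ V) = V` on
the target. [cite: LeeSmoothManifolds2013, Prop. 8.19] -/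
theorem mpullback_symm_chartField (hΦ : Φ ∈ IsManifold.maximalAtlas 𝓘(ℝ, E) ∞ M) {x : M}
    (hx : x ∈ Φ.source) :
    mpullback 𝓘(ℝ, E) 𝓘(ℝ, E) Φ.symm (chartField Φ V) (Φ x) = V (Φ x) := by
  have hn : (∞ : ℕ∞ω) ≠ 0 := by simp
  rw [mpullback_apply_eq_mfderiv (I := 𝓘(ℝ, E)) (I' := 𝓘(ℝ, E)) (Φ := Φ) (Ψ := Φ.symm)
    ((contMDiffAt_of_mem_maximalAtlas' hΦ hx).mdifferentiableAt hn)
    ((contMDiffAt_symm_of_mem_maximalAtlas' hΦ (Φ.map_source hx)).mdifferentiableAt hn)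
    (Φ.eventually_left_inverse hx) (Φ.eventually_right_inverse' hx)]
  exact mfderiv_apply_chartField hΦ hx

variable [FiniteDimensional ℝ E] [IsManifold 𝓘(ℝ, E) ∞ M] [T2Space M]

/-- **The push-forward of a smooth field with compact support inside the target of a chart of the
maximal atlas is a smooth vector field on `M`** (the version of
`IsFullChart.contMDiff_chartField` for a chart with arbitrary target): on the source it is the
pull-back of a smooth field along a smooth map with invertible differential; a point off the
source has the open neighbourhood `M ∖ Φ⁻¹(tsupport V)` on which the field vanishes.
[cite: LeeSmoothManifolds2013, Prop. 8.19] -/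
theorem contMDiff_chartField_of_tsupport_subset (hΦ : Φ ∈ IsManifold.maximalAtlas 𝓘(ℝ, E) ∞ M)
    (hV : ContDiff ℝ ∞ V) (hVc : HasCompactSupport V) (hsub : tsupport V ⊆ Φ.target) :
    ContMDiff 𝓘(ℝ, E) 𝓘(ℝ, E).tangent ∞
      fun x => (⟨x, chartField Φ V x⟩ : TangentBundle 𝓘(ℝ, E) M) := by
  haveI : CompleteSpace E := FiniteDimensional.complete ℝ E
  intro x
  by_cases hx : x ∈ Φ.source
  · have hVm : ContMDiffAt 𝓘(ℝ, E) 𝓘(ℝ, E).tangent ∞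
        (fun y : E ↦ (⟨y, (V y : TangentSpace 𝓘(ℝ, E) y)⟩ : TangentBundle 𝓘(ℝ, E) E)) (Φ x) :=
      contMDiffAt_vectorSpace_iff_contDiffAt.2 hV.contDiffAt
    have key := ContMDiffAt.mpullback_vectorField_preimage (n := ∞) hVm
      (contMDiffAt_of_mem_maximalAtlas' hΦ hx) (isInvertible_mfderiv_of_mem_maximalAtlas hΦ hx).1
      (by simp)
    refine key.congr_of_eventuallyEq ?_
    filter_upwards [Φ.open_source.mem_nhds hx] with y hy
    rw [chartField_of_mem hy]
  · -- off the source: the field is zero near `x`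
    have hK : IsClosed (Φ.symm '' tsupport V) :=
      (hVc.image_of_continuousOn ((Φ.continuousOn_symm).mono hsub)).isClosed
    have hxK : x ∉ Φ.symm '' tsupport V := by
      rintro ⟨y, hy, rfl⟩
      exact hx (Φ.map_target (hsub hy))
    have hzero : ∀ y ∉ Φ.symm '' tsupport V, chartField Φ V y = 0 := fun y hy ↦
      chartField_eq_zero_of_not_mem_image fun hy' ↦ hy (image_mono subset_closure hy')
    refine ((Bundle.contMDiff_zeroSection ℝ (TangentSpace 𝓘(ℝ, E) : M → Type _)) x).congr_of_eventuallyEq ?_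
    filter_upwards [hK.isOpen_compl.mem_nhds hxK] with y hy
    simp only [Bundle.zeroSection, hzero y hy]

end PartialChart

/-! ### §2 Integral curves of a radial field `y ↦ c • (o - y)` run along rays towards `o` -/

section RadialODE

variable {E : Type*} [NormedAddCommGroup E] [NormedSpace ℝ E]

/-- **Solutions of `γ' = c(t) (o - γ)` run along the ray towards `o`**:
`γ t - o = exp (-∫₀ᵗ c) • (γ 0 - o)` for a continuous coefficient `c` (the function
`exp (∫₀ᵗ c) • (γ t - o)` has derivative zero). [folklore] -/
theorem sub_eq_exp_smul_of_hasDerivAt {γ : ℝ → E} {c : ℝ → ℝ} {o : E} (hc : Continuous c)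
    (hγ : ∀ t, HasDerivAt γ (c t • (o - γ t)) t) (t : ℝ) :
    γ t - o = Real.exp (-∫ s in (0 : ℝ)..t, c s) • (γ 0 - o) := by
  set R : ℝ → ℝ := fun t => Real.exp (∫ s in (0 : ℝ)..t, c s) with hR
  have hI : ∀ t, HasDerivAt (fun u => ∫ s in (0 : ℝ)..u, c s) (c t) t := fun t =>
    intervalIntegral.integral_hasDerivAt_right (hc.intervalIntegrable _ _)
      (hc.stronglyMeasurableAtFilter _ _) hc.continuousAt
  have hRd : ∀ t, HasDerivAt R (R t * c t) t := fun t => by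
    simpa [hR] using (hI t).exp
  set φ : ℝ → E := fun t => R t • (γ t - o) with hφ
  have hφd : ∀ t, HasDerivAt φ (0 : E) t := by
    intro t
    have h1 : HasDerivAt (fun t => γ t - o) (c t • (o - γ t)) t := (hγ t).sub_const o
    have h2 : HasDerivAt (fun s => R s • (γ s - o))
        (R t • (c t • (o - γ t)) + (R t * c t) • (γ t - o)) t := (hRd t).smul h1
    have hzero : R t • (c t • (o - γ t)) + (R t * c t) • (γ t - o) = 0 := by
      rw [smul_smul, ← smul_add, show (o - γ t) + (γ t - o) = (0 : E) by abel, smul_zero]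
    rw [hzero] at h2
    exact h2
  have hconst : ∀ t, φ t = φ 0 := by
    intro t
    have hdiff : Differentiable ℝ φ := fun t => (hφd t).differentiableAt
    exact is_const_of_deriv_eq_zero hdiff (fun t => (hφd t).deriv) t 0
  have hφ0 : φ 0 = γ 0 - o := by simp [hφ, hR]
  have hRpos : 0 < R t := Real.exp_pos _
  have key : R t • (γ t - o) = γ 0 - o := by rw [← hφ0, ← hconst t]
  calc γ t - o = (R t)⁻¹ • (R t • (γ t - o)) := by
          rw [smul_smul, inv_mul_cancel₀ hRpos.ne', one_smul]
    _ = Real.exp (-∫ s in (0 : ℝ)..t, c s) • (γ 0 - o) := by rw [key, hR, Real.exp_neg]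

/-- **Forward tracks of a radial field with nonnegative coefficient**: if `γ' = c(t) (o - γ)` with
`c ≥ 0` continuous, then for `t₀ ≤ t` the point `γ t` lies on the segment from `o` to `γ t₀`:
`γ t = o + μ • (γ t₀ - o)` with `0 < μ ≤ 1`, namely `μ = exp (-∫_{t₀}^t c)`. [folklore] -/
theorem exists_eq_add_smul_of_hasDerivAt {γ : ℝ → E} {c : ℝ → ℝ} {o : E} (hc : Continuous c)
    (hc0 : ∀ t, 0 ≤ c t) (hγ : ∀ t, HasDerivAt γ (c t • (o - γ t)) t) {t₀ t : ℝ} (ht : t₀ ≤ t) :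
    ∃ μ : ℝ, 0 < μ ∧ μ ≤ 1 ∧ γ t = o + μ • (γ t₀ - o) := by
  -- shift time by `t₀`
  have hγ' : ∀ s, HasDerivAt (fun s => γ (s + t₀)) (c (s + t₀) • (o - γ (s + t₀))) s := fun s => by
    simpa using (hγ (s + t₀)).comp_add_const s t₀
  have key := sub_eq_exp_smul_of_hasDerivAt (c := fun s => c (s + t₀))
    (hc.comp (continuous_id.add continuous_const)) hγ' (t - t₀)
  simp only [sub_add_cancel, zero_add] at key
  refine ⟨Real.exp (-∫ s in (0 : ℝ)..(t - t₀), c (s + t₀)), Real.exp_pos _, ?_, ?_⟩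
  · rw [Real.exp_le_one_iff, neg_nonpos]
    exact intervalIntegral.integral_nonneg (sub_nonneg.2 ht) fun s _ => hc0 _
  · rw [← key]; abel

/-- **Exponential contraction where the coefficient is `1`**: if moreover `c = 1` along the track on
`[0, T]`, then `‖γ T - o‖ = e^{-T} ‖γ 0 - o‖`. [folklore] -/
theorem norm_sub_eq_exp_neg_mul_of_hasDerivAt {γ : ℝ → E} {c : ℝ → ℝ} {o : E} (hc : Continuous c)
    (hγ : ∀ t, HasDerivAt γ (c t • (o - γ t)) t) {T : ℝ} (hT : 0 ≤ T)
    (h1 : ∀ t ∈ Icc 0 T, c t = 1) : ‖γ T - o‖ = Real.exp (-T) * ‖γ 0 - o‖ := by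
  have key := sub_eq_exp_smul_of_hasDerivAt hc hγ T
  have hint : ∫ s in (0 : ℝ)..T, c s = T := by
    rw [intervalIntegral.integral_congr (g := fun _ => (1 : ℝ)) fun s hs => h1 s (by
      rwa [uIcc_of_le hT] at hs)]
    simp
  rw [key, hint, norm_smul, Real.norm_eq_abs, abs_of_pos (Real.exp_pos _)]

end RadialODE

/-! ### §3 Star-shaped sets: thickenings -/

section Star

variable {E : Type*} [NormedAddCommGroup E] [NormedSpace ℝ E]

/-- **The metric thickening of a set star-shaped about `o` is star-shaped about `o`.**
[folklore] -/
theorem starConvex_thickening {o : E} {H : Set E} (hH : StarConvex ℝ o H) (θ : ℝ) :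
    StarConvex ℝ o (Metric.thickening θ H) := by
  intro y hy a b ha hb hab
  rw [Metric.mem_thickening_iff] at hy ⊢
  obtain ⟨z, hz, hyz⟩ := hy
  refine ⟨a • o + b • z, hH hz ha hb hab, ?_⟩
  have hθ : 0 < θ := lt_of_le_of_lt dist_nonneg hyz
  calc dist (a • o + b • y) (a • o + b • z) = ‖b • (y - z)‖ := by
          rw [dist_eq_norm]; congr 1; rw [smul_sub]; abel
    _ = b * dist y z := by rw [norm_smul, Real.norm_eq_abs, abs_of_nonneg hb, dist_eq_norm]
    _ < θ := by
      rcases hb.eq_or_lt with rfl | hb'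
      · simpa using hθ
      · calc b * dist y z ≤ 1 * dist y z := by
                gcongr; linarith
          _ < θ := by simpa using hyz

/-- Points of a star-shaped set (about `o`) reached from `y` by moving towards `o` stay in the
set: `o + μ • (y - o) ∈ s` for `y ∈ s`, `0 ≤ μ ≤ 1`. [folklore] -/
theorem StarConvex.add_smul_sub_mem' {o y : E} {s : Set E} (hs : StarConvex ℝ o s) (hy : y ∈ s)
    {μ : ℝ} (h0 : 0 ≤ μ) (h1 : μ ≤ 1) : o + μ • (y - o) ∈ s :=
  hs.add_smul_sub_mem hy h0 h1

end Star

/-! ### §4 The engulfing diffeomorphism -/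

section Engulf

variable {E : Type*} [NormedAddCommGroup E] [NormedSpace ℝ E] [FiniteDimensional ℝ E]
  {M : Type*} [TopologicalSpace M] [ChartedSpace E M] [IsManifold 𝓘(ℝ, E) ∞ M] [T2Space M]

/-- **A smooth bump adapted to a compact set inside an open set** of a finite-dimensional real
normed space: `λ : E → [0, 1]` smooth, `λ = 1` on the compact `K`, with compact topological
support inside the open `W ⊇ K`. [folklore] -/
theorem exists_contDiff_bump_of_isCompact_subset_isOpen {K W : Set E} (hK : IsCompact K)
    (hW : IsOpen W) (hKW : K ⊆ W) :
    ∃ l : E → ℝ, ContDiff ℝ ∞ l ∧ (∀ y, l y ∈ Icc (0 : ℝ) 1) ∧ EqOn l 1 K ∧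
      HasCompactSupport l ∧ tsupport l ⊆ W := by
  obtain ⟨O, hO, hKO, hOW, hOc⟩ := exists_open_between_and_isCompact_closure hK hW hKW
  obtain ⟨f, hf0, hf1, hf01⟩ := exists_contMDiffMap_zero_one_of_isClosed 𝓘(ℝ, E) (n := ⊤)
    hO.isClosed_compl hK.isClosed (disjoint_compl_left_iff_subset.2 hKO)
  have hsupp : support f ⊆ O := fun y hy => by
    by_contra h
    exact hy (hf0 h)
  have htsupp : tsupport f ⊆ closure O := closure_mono hsupp
  refine ⟨f, ?_, hf01, hf1, ?_, htsupp.trans hOW⟩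
  · exact contMDiff_iff_contDiff.1 f.contMDiff
  · exact IsCompact.of_isClosed_subset hOc (isClosed_tsupport _) htsupp

set_option backward.isDefEq.respectTransparency false in
set_option maxHeartbeats 800000 in
/-- **Radial engulfing.**  Let `Φ` be a chart of the maximal atlas of the Hausdorff `C^∞`
manifold `M` (model `𝓘(ℝ, E)`, `E` finite-dimensional, no boundary), `Δ ⊆ Φ.target` compact and
star-shaped about `o`, `H ⊆ Φ.target` compact and star-shaped about `o` with `o ∈ H`, `C ⊆ M`
closed with `Φ⁻¹ y ∈ C → y ∈ H` for `y ∈ Δ`, `O ⊆ M` open with `C ⊆ O` and `Φ⁻¹(H) ⊆ O`, and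
`U ⊆ M` open with `Φ⁻¹(Δ) ⊆ U`.  Then there is a diffeomorphism `G : M → M` with `G(U) ⊆ U`,
`C ⊆ G(O)` and `Φ⁻¹(Δ) ⊆ G(O)`: the inverse of the time-`T` map of the flow of the push-forward
of a cut-off radial field `λ(y) (o - y)` (module docstring).  This is the smooth, one-cell form
of "a regular neighbourhood of `Y` stretches over `X ↘ Y`" (Rourke–Sanderson 1972, Ch. 3;
Rushing 1973, Ex. 1.6.12), the ambient move being a diffeotopy generated by a compactly supported
field (Hirsch 1976, Ch. 8 §1, Thm. 1.2). [cite: HirschDT1976, Ch. 8 §1, Thms. 1.1–1.2] -/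
theorem exists_diffeomorph_mapsTo_image_supset {Φ : OpenPartialHomeomorph M E}
    (hΦ : Φ ∈ IsManifold.maximalAtlas 𝓘(ℝ, E) ∞ M) {o : E} {Δ H : Set E} {C O U : Set M}
    (hΔc : IsCompact Δ) (hΔo : StarConvex ℝ o Δ) (hΔt : Δ ⊆ Φ.target)
    (hHc : IsCompact H) (hHo : StarConvex ℝ o H) (hoH : o ∈ H) (hHt : H ⊆ Φ.target)
    (hC : IsClosed C) (hCΔ : ∀ y ∈ Δ, Φ.symm y ∈ C → y ∈ H)
    (hO : IsOpen O) (hCO : C ⊆ O) (hHO : MapsTo Φ.symm H O)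
    (hU : IsOpen U) (hΔU : MapsTo Φ.symm Δ U) :
    ∃ G : M ≃ₘ^∞⟮𝓘(ℝ, E), 𝓘(ℝ, E)⟯ M, MapsTo G U U ∧ C ⊆ G '' O ∧ Φ.symm '' Δ ⊆ G '' O := by
  haveI : CompleteSpace E := FiniteDimensional.complete ℝ E
  have hn : (∞ : ℕ∞ω) ≠ 0 := by simp
  /- Step 1: `θ > 0` with the `θ`-thickening of `H` (within the target) read back into `O`. -/
  set OE : Set E := Φ.target ∩ Φ.symm ⁻¹' O with hOE
  have hOEo : IsOpen OE := Φ.symm.isOpen_inter_preimage hO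
  have hHOE : H ⊆ OE := fun y hy => ⟨hHt hy, hHO hy⟩
  obtain ⟨θ, hθ, hθO⟩ := hHc.exists_thickening_subset_open hOEo hHOE
  /- Step 2: the region where the field is allowed: inside the target, over `U`, and away from
  the points over `C` that are `θ`-far from `H`. -/
  set TU : Set E := Φ.target ∩ Φ.symm ⁻¹' U with hTU
  have hTUo : IsOpen TU := Φ.symm.isOpen_inter_preimage hU
  set W : Set E := TU ∩ ((Φ.target ∩ Φ.symm ⁻¹' Cᶜ) ∪ Metric.thickening θ H) with hW
  have hWo : IsOpen W :=
    hTUo.inter ((Φ.symm.isOpen_inter_preimage hC.isOpen_compl).union Metric.isOpen_thickening)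
  -- the compact set where full speed is required
  set Δθ : Set E := Δ ∩ {y | θ ≤ Metric.infDist y H} with hΔθ
  have hΔθc : IsCompact Δθ :=
    hΔc.inter_right (isClosed_le continuous_const (Metric.continuous_infDist_pt H))
  have hHne : H.Nonempty := ⟨o, hoH⟩
  have hnotθ : ∀ y ∈ Δθ, y ∉ Metric.thickening θ H := fun y hy hth => by
    rw [Metric.mem_thickening_iff_infDist_lt hHne] at hth
    exact absurd hy.2 (not_le.2 hth)
  have hΔθW : Δθ ⊆ W := by
    intro y hy
    refine ⟨⟨hΔt hy.1, hΔU hy.1⟩, Or.inl ⟨hΔt hy.1, ?_⟩⟩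
    intro hyC
    exact hnotθ y hy (Metric.mem_thickening_iff_infDist_lt hHne |>.2
      (by rw [Metric.infDist_zero_of_mem (hCΔ y hy.1 hyC)]; exact hθ))
  /- Step 3: the bump and the field. -/
  obtain ⟨l, hl, hl01, hl1, hlc, hlW⟩ := exists_contDiff_bump_of_isCompact_subset_isOpen hΔθc hWo hΔθW
  set V : E → E := fun y => l y • (o - y) with hV
  have hVs : ContDiff ℝ ∞ V := hl.smul (contDiff_const.sub contDiff_id)
  have hVsupp : support V ⊆ support l := fun y hy => by
    intro hly
    exact hy (by simp [hV, hly])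
  have hVts : tsupport V ⊆ tsupport l := closure_mono hVsupp
  have hVc : HasCompactSupport V := hlc.mono hVsupp
  have hVt : tsupport V ⊆ Φ.target := fun y hy => (hlW (hVts hy)).1.1
  have hlt : tsupport l ⊆ Φ.target := fun y hy => (hlW hy).1.1
  set X := chartField Φ V with hX
  have hXs := contMDiff_chartField_of_tsupport_subset hΦ hVs hVc hVt
  -- the support of `X` in `M`
  set S : Set M := Φ.symm '' tsupport l with hS
  have hSc : IsCompact S := hlc.image_of_continuousOn (Φ.continuousOn_symm.mono hlt)
  have hSsrc : S ⊆ Φ.source := by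
    rintro _ ⟨y, hy, rfl⟩
    exact Φ.map_target (hlt hy)
  have hSU : S ⊆ U := by
    rintro _ ⟨y, hy, rfl⟩
    exact (hlW hy).1.2
  have hXS : ∀ x, x ∉ S → X x = 0 := fun x hx =>
    chartField_eq_zero_of_not_mem_image fun ⟨y, hy, hyx⟩ => hx ⟨y, hVts (subset_closure hy), hyx⟩
  /- Step 4: the flow. -/
  obtain ⟨ε, hε, hu⟩ := hasUniformLocalFlow_of_isCompact_support hXs hSc hSc.isClosed hXS
  set ψ := uflow hXs hε hu with hψ
  have hfix : ∀ x, x ∉ S → ∀ t, ψ x t = x := fun x hx t =>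
    uflowIsotopy_apply_of_eq_zero hXs hε hu (hXS x hx) t
  have hinv : ∀ x ∈ S, ∀ t, ψ x t ∈ S := by
    intro x hx t
    by_contra hxt
    have h1 : ψ (ψ x t) (-t) = ψ x t := hfix _ hxt (-t)
    have h2 : ψ (ψ x t) (-t) = x := uflow_neg_uflow hXs hε hu x t
    exact hxt (h2.symm.trans h1 ▸ hx)
  /- Step 5: tracks read in the chart are integral curves of `V`. -/
  have htrack : ∀ x ∈ S, ∀ t, HasDerivAt (fun s => Φ (ψ x s)) (V (Φ (ψ x t))) t := by
    intro x hx t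
    have hsrc : ψ x t ∈ Φ.source := hSsrc (hinv x hx t)
    have hγ : HasMFDerivAt 𝓘(ℝ, ℝ) 𝓘(ℝ, E) (ψ x) t
        ((1 : ℝ →L[ℝ] ℝ).smulRight (X (ψ x t))) := isMIntegralCurve_uflow hXs hε hu x t
    have hcomp := HasMFDerivWithinAt.comp_mpullback (I := 𝓘(ℝ, E)) (I' := 𝓘(ℝ, E)) (Φ := Φ)
      (Ψ := Φ.symm) (s := univ) hγ.hasMFDerivWithinAt
      ((contMDiffAt_of_mem_maximalAtlas' hΦ hsrc).mdifferentiableAt hn)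
      ((contMDiffAt_symm_of_mem_maximalAtlas' hΦ (Φ.map_source hsrc)).mdifferentiableAt hn)
      (Φ.eventually_left_inverse hsrc) (Φ.eventually_right_inverse' hsrc)
    rw [mpullback_symm_chartField hΦ hsrc] at hcomp
    have h3 : HasMFDerivAt 𝓘(ℝ, ℝ) 𝓘(ℝ, E) (Φ ∘ ψ x) t
        ((1 : ℝ →L[ℝ] ℝ).smulRight (V (Φ (ψ x t)))) := hcomp.hasMFDerivAt univ_mem
    have h4 : HasFDerivAt (Φ ∘ ψ x) ((1 : ℝ →L[ℝ] ℝ).smulRight (V (Φ (ψ x t)))) t :=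
      (hasMFDerivAt_iff_hasFDerivAt (f := Φ ∘ ψ x)).1 h3
    have h5 : HasDerivAt (Φ ∘ ψ x) (V (Φ (ψ x t))) t := by
      have := h4.hasDerivAt
      simpa only [ContinuousLinearMap.smulRight_apply, one_apply_eq_self,
        one_smul] using this
    exact h5
  /- Step 6: geometry of the tracks. -/
  have hlcont : Continuous l := hl.continuous
  have hl0 : ∀ y, 0 ≤ l y := fun y => (hl01 y).1
  -- forward invariance of `Δ` and of the thickening, for tracks starting over them
  have hray : ∀ x ∈ S, ∀ {t₀ t : ℝ}, t₀ ≤ t →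
      ∃ μ : ℝ, 0 < μ ∧ μ ≤ 1 ∧ Φ (ψ x t) = o + μ • (Φ (ψ x t₀) - o) := by
    intro x hx t₀ t ht
    exact exists_eq_add_smul_of_hasDerivAt (γ := fun s => Φ (ψ x s)) (c := fun s => l (Φ (ψ x s)))
      (hlcont.comp (continuous_iff_continuousAt.2 fun s => (htrack x hx s).continuousAt))
      (fun s => hl0 _) (fun s => htrack x hx s) ht
  -- radius of `Δ` about `o`
  obtain ⟨R, hR, hΔR⟩ : ∃ R : ℝ, 0 < R ∧ ∀ y ∈ Δ, ‖y - o‖ ≤ R := by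
    obtain ⟨R, hR⟩ := (hΔc.image (continuous_id.sub continuous_const)).isBounded.subset_closedBall 0
    refine ⟨max R 1, by positivity, fun y hy => ?_⟩
    have := hR (mem_image_of_mem _ hy)
    rw [mem_closedBall, dist_zero_right] at this
    exact this.trans (le_max_left _ _)
  -- the time
  set T : ℝ := R / θ + 1 with hT
  have hT0 : 0 ≤ T := by positivity
  have hexp : Real.exp (-T) * R < θ := by
    have h1 : R / θ < T := by rw [hT]; linarith
    have h2 : R < θ * T := by rwa [div_lt_iff₀ hθ, mul_comm] at h1
    have h3 : T < Real.exp T := by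
      have := Real.add_one_lt_exp (by positivity : T ≠ 0)
      linarith
    rw [Real.exp_neg, inv_mul_lt_iff₀ (Real.exp_pos T)]
    nlinarith [Real.exp_pos T]
  /- Step 7: at time `T` every point over `Δ` and every point of `C` is in `O`. -/
  have hthickO : ∀ x ∈ S, ∀ t, Φ (ψ x t) ∈ Metric.thickening θ H → ψ x t ∈ O := by
    intro x hx t hth
    have hsrc : ψ x t ∈ Φ.source := hSsrc (hinv x hx t)
    have hmem : Φ (ψ x t) ∈ OE := hθO hth
    have := hmem.2
    rwa [mem_preimage, Φ.left_inv hsrc] at this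
  have hΔT : ∀ y ∈ Δ, ψ (Φ.symm y) T ∈ O := by
    intro y hy
    by_cases hxS : Φ.symm y ∈ S
    · -- the track starts at `y`
      have hy0 : Φ (ψ (Φ.symm y) 0) = y := by
        rw [hψ, uflow_zero, Φ.right_inv (hΔt hy)]
      by_cases hex : ∃ t₀ ∈ Icc 0 T, Φ (ψ (Φ.symm y) t₀) ∈ Metric.thickening θ H
      · obtain ⟨t₀, ht₀, hth⟩ := hex
        obtain ⟨μ, hμ0, hμ1, hμ⟩ := hray _ hxS ht₀.2
        refine hthickO _ hxS T ?_
        rw [hμ]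
        exact (starConvex_thickening hHo θ).add_smul_sub_mem hth hμ0.le hμ1
      · push Not at hex
        -- the track stays in `Δθ` on `[0, T]`, so contracts by `e^{-T}`
        have hstay : ∀ t ∈ Icc 0 T, Φ (ψ (Φ.symm y) t) ∈ Δθ := by
          intro t ht
          obtain ⟨μ, hμ0, hμ1, hμ⟩ := hray _ hxS ht.1
          refine ⟨?_, ?_⟩
          · rw [hμ, hy0]; exact hΔo.add_smul_sub_mem hy hμ0.le hμ1
          · have := hex t ht
            rw [Metric.mem_thickening_iff_infDist_lt hHne, not_lt] at this
            exact this
        have hnorm := norm_sub_eq_exp_neg_mul_of_hasDerivAt (γ := fun s => Φ (ψ (Φ.symm y) s))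
          (c := fun s => l (Φ (ψ (Φ.symm y) s)))
          (hlcont.comp (continuous_iff_continuousAt.2 fun s => (htrack _ hxS s).continuousAt))
          (fun s => htrack _ hxS s) hT0 (fun t ht => hl1 (hstay t ht))
        simp only [hy0] at hnorm
        have hlt : ‖Φ (ψ (Φ.symm y) T) - o‖ < θ := by
          rw [hnorm]
          calc Real.exp (-T) * ‖y - o‖ ≤ Real.exp (-T) * R := by
                  gcongr; exact hΔR y hy
            _ < θ := hexp
        have hth : Φ (ψ (Φ.symm y) T) ∈ Metric.thickening θ H :=
          Metric.mem_thickening_iff.2 ⟨o, hoH, by rwa [dist_eq_norm]⟩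
        exact absurd hth (hnotθ _ (hstay T ⟨hT0, le_rfl⟩))
    · -- the point does not move; it lies over `Δ ∖ Δθ` or over `o`
      rw [hfix _ hxS T]
      by_cases hly : y ∈ tsupport l
      · exact absurd ⟨y, hly, rfl⟩ hxS
      · have hl0y : l y = 0 := image_eq_zero_of_notMem_tsupport hly
        have hyθ : y ∉ Δθ := fun h => by
          have := hl1 h
          simp [hl0y] at this
        have hth : y ∈ Metric.thickening θ H := by
          rw [Metric.mem_thickening_iff_infDist_lt hHne]
          by_contra h
          exact hyθ ⟨hy, not_lt.1 h⟩
        exact (hθO hth).2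
  have hCT : ∀ x ∈ C, ψ x T ∈ O := by
    intro x hx
    by_cases hxS : x ∈ S
    · obtain ⟨y, hy, rfl⟩ := hxS
      have hyW := hlW hy
      have hyC : Φ.symm y ∈ C := hx
      have hth : y ∈ Metric.thickening θ H := by
        rcases hyW.2 with h | h
        · exact absurd hyC h.2
        · exact h
      have hy0 : Φ (ψ (Φ.symm y) 0) = y := by
        rw [hψ, uflow_zero, Φ.right_inv (hlt hy)]
      obtain ⟨μ, hμ0, hμ1, hμ⟩ := hray _ ⟨y, hy, rfl⟩ hT0
      refine hthickO _ ⟨y, hy, rfl⟩ T ?_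
      rw [hμ, hy0]
      exact (starConvex_thickening hHo θ).add_smul_sub_mem hth hμ0.le hμ1
    · rw [hfix x hxS T]
      exact hCO hx
  /- Step 8: the diffeomorphism. -/
  refine ⟨(uflowStage hXs hε hu T).symm, ?_, ?_, ?_⟩
  · intro z hz
    change ψ z (-T) ∈ U
    by_cases hzS : z ∈ S
    · exact hSU (hinv z hzS (-T))
    · rw [hfix z hzS]; exact hz
  · intro x hx
    refine ⟨ψ x T, hCT x hx, ?_⟩
    change ψ (ψ x T) (-T) = x
    exact uflow_neg_uflow hXs hε hu x T
  · rintro _ ⟨y, hy, rfl⟩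
    refine ⟨ψ (Φ.symm y) T, hΔT y hy, ?_⟩
    change ψ (ψ (Φ.symm y) T) (-T) = Φ.symm y
    exact uflow_neg_uflow hXs hε hu _ T

end Engulf

end Literature.Topology.FourManifolds
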